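import Summits.KontsevichZagierPeriods.KontsevichZagierPeriods.Theorems.RootDecompRelativeModAbsoluteCylLogSplitP39

/-! # `RootDecompRelativeModAbsoluteCylLogSplitP40` — part 15/27 of the mechanical ≤400-line split of `RungClosure.lean` (sha256 f909f334226f0fb5…)
Source: decomp-kz lens-3 g12 `RungClosure.lean` v9 (HOME/decomp-kz-lens-3/g12/, sha256 f909f334…; critic g4-52/g4-57/g5 CLEARED, «lander: split v9 --supports 30572»): BLOCK I (57 g11 monolith decls missing from P01–P25), BLOCK II/III (WildCertAssembly parts 1–6, 8–10: `Leaf.cellLocalWildCert`, `Leaf.cylKernelZeroLog_of_trees`), Parts 12–13 (`Leaf.regKernelPairDegOne_iff_circlePos_of_trees`), BLOCK G13 (Möbius engine, test §C decided).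
Split by census-1 g9 `gen/splitlean.py`: scopes re-opened with their `open`/`variable`/`set_option` context; mathematics and declaration order unchanged. -/

noncomputable section
open Set MeasureTheory Filter Topology
open scoped BigOperators
open Literature.NumberTheory.Transcendental Literature.ModelTheory.ExponentialFields
namespace Summit.KontsevichZagierPeriods.RootDecompRelativeModAbsolute.Rung30571.RegularisedLogLayer.CylLog.Leaf

/-- **THE LATTICE SPLIT, Γ-form (T1Γ).**  As `Lattice.latticeSplit`, with the extra datum `α` and the clause
`A s r = Σ_k α s k · f r k` (the `K`-coordinate functionals extended from the span `V` to the ambient `ℚ^q`). -/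
theorem latticeSplitΓ (q R : ℕ) (f : Fin R → Fin q → ℤ) (Z : Fin q → Bool) :
    ∃ (a b : ℕ) (g : Fin a → Fin q → ℤ) (h : Fin b → Fin q → ℤ) (A : Fin a → Fin R → ℚ) (B : Fin b → Fin R → ℚ)
      (β : Fin b → Fin q → ℚ) (α : Fin a → Fin q → ℚ),
      (∀ s i, Z i = false → g s i = 0) ∧
      (∀ s, ∃ N : ℕ, 0 < N ∧ ∃ z : Fin R → ℤ, ∀ i, (N : ℤ) * g s i = ∑ r, z r * f r i) ∧
      (∀ t, ∃ N : ℕ, 0 < N ∧ ∃ z : Fin R → ℤ, ∀ i, (N : ℤ) * h t i = ∑ r, z r * f r i) ∧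
      (∀ t k, Z k = true → β t k = 0) ∧
      (∀ r i, (f r i : ℚ) = ∑ s, A s r * g s i + ∑ t, B t r * h t i) ∧
      (∀ t r, B t r = ∑ k, β t k * f r k) ∧
      (∀ s r, A s r = ∑ k, α s k * f r k) := by
  classical
  -- the ambient space, the span, the projection to the tame coordinates
  set F : Fin R → Fin q → ℚ := fun r i => (f r i : ℚ) with hF
  set V : Submodule ℚ (Fin q → ℚ) := Submodule.span ℚ (Set.range F) with hV
  let Tm := {k : Fin q // Z k = false}
  let π : (Fin q → ℚ) →ₗ[ℚ] (Tm → ℚ) :=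
    { toFun := fun v k => v k.1
      map_add' := fun v w => rfl
      map_smul' := fun c v => rfl }
  let ρ : V →ₗ[ℚ] (Tm → ℚ) := π.comp V.subtype
  let K : Submodule ℚ V := LinearMap.ker ρ
  obtain ⟨W, hKW⟩ := Submodule.exists_isCompl K
  -- bases
  haveI : Module.Free ℚ K := Module.Free.of_divisionRing ℚ K
  haveI : Module.Free ℚ W := Module.Free.of_divisionRing ℚ W
  let bK := Module.finBasis ℚ K
  let bW := Module.finBasis ℚ W
  set a := Module.finrank ℚ K with ha
  set b := Module.finrank ℚ W with hb
  let e : (K × W) ≃ₗ[ℚ] V := Submodule.prodEquivOfIsCompl K W hKW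
  let bV : Module.Basis (Fin a ⊕ Fin b) ℚ V := (bK.prod bW).map e
  -- underlying rational vectors
  let uK : Fin a → Fin q → ℚ := fun s => ((bK s : K) : V)
  let uW : Fin b → Fin q → ℚ := fun t => ((bW t : W) : V)
  have hbV_inl : ∀ s, ((bV (Sum.inl s) : V) : Fin q → ℚ) = uK s := by
    intro s
    simp [bV, uK, e, Module.Basis.map_apply, Module.Basis.prod_apply, Submodule.coe_prodEquivOfIsCompl']
  have hbV_inr : ∀ t, ((bV (Sum.inr t) : V) : Fin q → ℚ) = uW t := by
    intro t
    simp [bV, uW, e, Module.Basis.map_apply, Module.Basis.prod_apply, Submodule.coe_prodEquivOfIsCompl']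
  -- support of the `K`-vectors
  have huK_supp : ∀ s (k : Fin q), Z k = false → uK s k = 0 := by
    intro s k hk
    have hmem : ((bK s : K) : V) ∈ K := (bK s).2
    have h0 : ρ ((bK s : K) : V) = 0 := LinearMap.mem_ker.1 hmem
    have h1 : ρ ((bK s : K) : V) ⟨k, hk⟩ = 0 := by rw [h0]; rfl
    exact h1
  -- integer scalings
  choose NK hNK zK hzK using fun s => Lattice.exists_nat_mul_eq_int (uK s)
  choose NW hNW zW hzW using fun t => Lattice.exists_nat_mul_eq_int (uW t)
  -- membership in V of the scaled vectors (as rational vectors)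
  have hgV : ∀ s, (fun i => (zK s i : ℚ)) ∈ V := by
    intro s
    have : (fun i => (zK s i : ℚ)) = (NK s : ℚ) • uK s := by
      ext i; simp [Pi.smul_apply, hzK s i]
    rw [this]
    exact V.smul_mem _ ((bK s : K) : V).2
  have hhV : ∀ t, (fun i => (zW t i : ℚ)) ∈ V := by
    intro t
    have : (fun i => (zW t i : ℚ)) = (NW t : ℚ) • uW t := by
      ext i; simp [Pi.smul_apply, hzW t i]
    rw [this]
    exact V.smul_mem _ ((bW t : W) : V).2
  -- the W-coordinate functionals vanish on K and factor through ρ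
  have hcoordK : ∀ t (v : V), v ∈ K → bV.repr v (Sum.inr t) = 0 := by
    intro t v hv
    have : bV.repr v = (bK.prod bW).repr (e.symm v) := by simp [bV]
    rw [this]
    have hsymm : e.symm v = ((⟨v, hv⟩ : K), 0) := Submodule.prodEquivOfIsCompl_symm_apply_left K W hKW ⟨v, hv⟩
    rw [hsymm, Module.Basis.prod_repr_inr]
    simp
  have hfactor : ∀ t, ∃ φ : (Tm → ℚ) →ₗ[ℚ] ℚ, ∀ v : V, φ (ρ v) = bV.repr v (Sum.inr t) := by
    intro t
    let ct : V →ₗ[ℚ] ℚ := bV.coord (Sum.inr t)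
    have hle : K ≤ LinearMap.ker ct := fun v hv => by
      rw [LinearMap.mem_ker]
      exact hcoordK t v hv
    let f₀ : LinearMap.range ρ →ₗ[ℚ] ℚ := (K.liftQ ct hle).comp (ρ.quotKerEquivRange.symm : LinearMap.range ρ →ₗ[ℚ] V ⧸ K)
    obtain ⟨φ, hφ⟩ := LinearMap.exists_extend f₀
    refine ⟨φ, fun v => ?_⟩
    have hmem : ρ v ∈ LinearMap.range ρ := LinearMap.mem_range_self ρ v
    have h1 : φ (ρ v) = f₀ ⟨ρ v, hmem⟩ := by
      have := LinearMap.congr_fun hφ ⟨ρ v, hmem⟩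
      simpa using this
    rw [h1]
    simp only [f₀, LinearMap.comp_apply, LinearEquiv.coe_coe, LinearMap.quotKerEquivRange_symm_apply_image,
      Submodule.mkQ_apply, Submodule.liftQ_apply]
    rfl
  choose φ hφ using hfactor
  -- the K-coordinate functionals extended from `V` to the ambient space (the Γ datum)
  have hext : ∀ s, ∃ G : (Fin q → ℚ) →ₗ[ℚ] ℚ, ∀ v : V, G (v : Fin q → ℚ) = bV.repr v (Sum.inl s) := by
    intro s
    obtain ⟨G, hG⟩ := LinearMap.exists_extend (bV.coord (Sum.inl s) : V →ₗ[ℚ] ℚ)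
    refine ⟨G, fun v => ?_⟩
    have h1 := LinearMap.congr_fun hG v
    simpa using h1
  choose G hG using hext
  -- the data
  let fr : Fin R → V := fun r => ⟨F r, Submodule.subset_span ⟨r, rfl⟩⟩
  refine ⟨a, b, zK, zW, fun s r => bV.repr (fr r) (Sum.inl s) / NK s, fun t r => bV.repr (fr r) (Sum.inr t) / NW t,
    fun t k => if hk : Z k = false then φ t (Pi.single (⟨k, hk⟩ : Tm) 1) / NW t else 0,
    fun s k => G s (Pi.single (M := fun _ => ℚ) k 1) / NK s,
    ?_, ?_, ?_, ?_, ?_, ?_, ?_⟩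
  · -- support of g
    intro s i hi
    have h1 := hzK s i
    rw [huK_supp s i hi, mul_zero] at h1
    exact_mod_cast h1.symm
  · -- g_s has an integer multiple in the ℤ-span of the f_r
    intro s
    obtain ⟨N, hN, z, hz⟩ := Lattice.exists_nat_mul_mem_zspan f (hgV s)
    exact ⟨N, hN, z, fun i => by exact_mod_cast hz i⟩
  · intro t
    obtain ⟨N, hN, z, hz⟩ := Lattice.exists_nat_mul_mem_zspan f (hhV t)
    exact ⟨N, hN, z, fun i => by exact_mod_cast hz i⟩
  · -- β supported off Z
    intro t k hk
    simp [hk]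
  · -- (I1): f_r = Σ A g + Σ B h
    intro r i
    beta_reduce
    have hsum := bV.sum_repr (fr r)
    have hcoe := congr_arg (fun v : V => (V.subtype v) i) hsum
    simp only [map_add, map_sum, map_smul, Fintype.sum_sum_type, Finset.sum_apply, Pi.add_apply,
      Pi.smul_apply, smul_eq_mul, Submodule.subtype_apply, hbV_inl, hbV_inr] at hcoe
    have hfr : ((fr r : V) : Fin q → ℚ) i = (f r i : ℚ) := rfl
    rw [hfr] at hcoe
    rw [← hcoe]
    congr 1
    · refine Finset.sum_congr rfl fun s _ => ?_
      have hN : (NK s : ℚ) ≠ 0 := by exact_mod_cast (hNK s).ne'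
      rw [← hzK s i]
      field_simp
    · refine Finset.sum_congr rfl fun t _ => ?_
      have hN : (NW t : ℚ) ≠ 0 := by exact_mod_cast (hNW t).ne'
      rw [← hzW t i]
      field_simp
  · -- (I2): B_tr = Σ_k β_tk f_rk  (KEY FACT)
    intro t r
    beta_reduce
    have hN : (NW t : ℚ) ≠ 0 := by exact_mod_cast (hNW t).ne'
    have key : bV.repr (fr r) (Sum.inr t) = φ t (ρ (fr r)) := (hφ t (fr r)).symm
    -- ρ (fr r) = Σ_{k : Tm} F r k • single k 1
    have hρ : ρ (fr r) = ∑ k : Tm, F r k.1 • Pi.single (M := fun _ => ℚ) k 1 := by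
      have := pi_eq_sum_univ' (ρ (fr r))
      simpa [ρ, π, fr] using this
    rw [key, hρ, map_sum]
    simp only [map_smul, smul_eq_mul]
    -- split the sum over Fin q into Z k = false and Z k = true parts
    rw [← Fintype.sum_subtype_add_sum_subtype (fun k => Z k = false)
      (fun k => (if hk : Z k = false then φ t (Pi.single (⟨k, hk⟩ : Tm) 1) / NW t else 0) * (f r k : ℚ))]
    have hzero : ∑ k : {x // ¬ Z x = false},
        (if hk : Z (k : Fin q) = false then φ t (Pi.single (⟨k, hk⟩ : Tm) 1) / NW t else 0) * (f r k : ℚ) = 0 := by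
      refine Finset.sum_eq_zero fun k _ => ?_
      simp [k.2]
    rw [hzero, add_zero, Finset.sum_div]
    refine Finset.sum_congr rfl fun k _ => ?_
    have hk : Z k.1 = false := k.2
    simp only [hk, dif_pos]
    simp [F, mul_comm, mul_div_assoc]
  · -- (I3): A_sr = Σ_k α_sk f_rk  (the Γ datum)
    intro s r
    beta_reduce
    have hN : (NK s : ℚ) ≠ 0 := by exact_mod_cast (hNK s).ne'
    have key : bV.repr (fr r) (Sum.inl s) = G s (F r) := (hG s (fr r)).symm
    have hFr : F r = ∑ k, F r k • Pi.single (M := fun _ => ℚ) k 1 := pi_eq_sum_univ' (F r)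
    rw [key, hFr, map_sum]
    simp only [map_smul, smul_eq_mul, Finset.sum_div]
    refine Finset.sum_congr rfl fun k _ => ?_
    simp [F, mul_comm, mul_div_assoc]

/-- Pointwise form of a coefficient identity `B r = Σ_k β_k f_rk`: `Σ_r B_r qq_r = Σ_k β_k (Σ_r qq_r f_rk)`. -/
theorem sum_coeff_comb {q R : ℕ} {f : Fin R → Fin q → ℤ} {B : Fin R → ℚ} {β : Fin q → ℚ}
    (hI : ∀ r, B r = ∑ k, β k * f r k) (qq : Fin R → ℝ) :
    ∑ r, (B r : ℝ) * qq r = ∑ k, (β k : ℝ) * ∑ r, qq r * (f r k : ℝ) := by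
  have hc : ∀ r, (B r : ℝ) = ∑ k, (β k : ℝ) * (f r k : ℝ) := by
    intro r
    have := congr_arg (fun x : ℚ => (x : ℝ)) (hI r)
    push_cast at this
    exact_mod_cast this
  simp_rw [hc, Finset.sum_mul, Finset.mul_sum]
  rw [Finset.sum_comm]
  refine Finset.sum_congr rfl fun k _ => Finset.sum_congr rfl fun r _ => ?_
  ring

/-! ## Part 9 — T3 (g12): the WILD CERTIFICATE of a piece from POINTWISE bounds
On a piece `C` where the indices `Z` are SMALL (`|κᵢ| ≤ 1/2`), the other nonconstant indices are `δ`-AWAY from their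
zero, the `Z`-rates are COMPARABLE after raising to order `m` (`|κᵢ|^{m+1} ≤ Cρ·|κₖ|^{Mₖ+1}`), and the torus products
`∏_{Z} Wᵢ^{(g_s)ᵢ⁺}` keep one side of `1`, the twenty clauses of `WildCellCert` hold with the data of the Γ-lattice
split: `qq'_s = Σ_k α_sk d̂_k`, `Ñᵢ = Σ_t pp_t h_ti`, `pp_t = Σ_{k∉Z} β_tk d̂_k` — every integrand is `L¹ × bounded`
(`cₖ ∈ L¹` for `k ∈ Z`, `d̂ₖ ∈ L¹` for `k ∉ Z`). -/

section T3

variable {q : ℕ}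

/-- Integrability by domination `|G| ≤ L·|F|` on a measurable piece. -/
theorem integrableOn_of_abs_le_mul {C : Set (Fin 1 → ℝ)} (hCm : MeasurableSet C) {F G : (Fin 1 → ℝ) → ℝ}
    (hF : IntegrableOn F C) (hG : AEStronglyMeasurable G (volume.restrict C)) (L : ℝ)
    (hb : ∀ x ∈ C, |G x| ≤ L * |F x|) : IntegrableOn G C :=
  Integrable.mono' ((hF.abs).const_mul L) hG (by
    filter_upwards [ae_restrict_mem hCm] with x hx
    rw [Real.norm_eq_abs]
    exact hb x hx)

/-- `Σᵢ nᵢ · log Wᵢ = 0` from `∏ Wᵢ^{nᵢ} = 1` (`Wᵢ > 0`). -/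
theorem sum_mul_log_eq_zero_of_prod_zpow {W : Fin q → ℝ} (hW : ∀ i, 0 < W i) {n : Fin q → ℤ}
    (h : ∏ i, W i ^ (n i) = 1) : ∑ i, (n i : ℝ) * Real.log (W i) = 0 := by
  have h1 := congr_arg Real.log h
  rw [Real.log_one, Real.log_prod (s := Finset.univ) (fun i _ => (zpow_pos (hW i) _).ne')] at h1
  simpa [Real.log_zpow] using h1

/-- `|(1+t)^n − 1| ≤ n·2^n·|t|` for `|t| ≤ 1/2`. -/
theorem abs_one_add_pow_sub_one_le {t : ℝ} (ht : |t| ≤ 1 / 2) :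
    ∀ n : ℕ, |(1 + t) ^ n - 1| ≤ (n : ℝ) * 2 ^ n * |t|
  | 0 => by simp
  | n + 1 => by
    have ih := abs_one_add_pow_sub_one_le ht n
    have h1 : (1 + t) ^ (n + 1) - 1 = (1 + t) * ((1 + t) ^ n - 1) + t := by ring
    have h1t : |1 + t| ≤ 2 := by
      have h2 : |1 + t| ≤ |(1:ℝ)| + |t| := abs_add_le 1 t
      rw [abs_one] at h2
      linarith
    have h2n : (1:ℝ) ≤ 2 ^ n := one_le_pow₀ (by norm_num)
    have hih0 : 0 ≤ (n : ℝ) * 2 ^ n * |t| := by positivity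
    rw [h1]
    calc |(1 + t) * ((1 + t) ^ n - 1) + t| ≤ |(1 + t) * ((1 + t) ^ n - 1)| + |t| := abs_add_le _ _
      _ = |1 + t| * |(1 + t) ^ n - 1| + |t| := by rw [abs_mul]
      _ ≤ 2 * ((n : ℝ) * 2 ^ n * |t|) + |t| :=
          add_le_add (mul_le_mul h1t ih (abs_nonneg _) zero_le_two) le_rfl
      _ ≤ ((n + 1 : ℕ) : ℝ) * 2 ^ (n + 1) * |t| := by
          push_cast
          rw [pow_succ]
          nlinarith [abs_nonneg t, h2n]

/-- `|∏_{i∈S} aᵢ − 1| ≤ (∏_{i∈S} Aᵢ)·Σ_{i∈S} eᵢ` when `|aᵢ − 1| ≤ eᵢ`, `|aᵢ| ≤ Aᵢ` and `1 ≤ Aᵢ`. -/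
theorem abs_prod_sub_one_le {ι : Type*} (S : Finset ι) {a e A : ι → ℝ}
    (he : ∀ i ∈ S, |a i - 1| ≤ e i) (hA : ∀ i ∈ S, |a i| ≤ A i) (hA1 : ∀ i ∈ S, 1 ≤ A i) :
    |∏ i ∈ S, a i - 1| ≤ (∏ i ∈ S, A i) * ∑ i ∈ S, e i := by
  classical
  induction S using Finset.induction_on with
  | empty => simp
  | insert j S hj ih =>
    have he' := fun i hi => he i (Finset.mem_insert_of_mem hi)
    have hA' := fun i hi => hA i (Finset.mem_insert_of_mem hi)
    have hA1' := fun i hi => hA1 i (Finset.mem_insert_of_mem hi)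
    have ih' := ih he' hA' hA1'
    have hej : |a j - 1| ≤ e j := he j (Finset.mem_insert_self j S)
    have hAj : |a j| ≤ A j := hA j (Finset.mem_insert_self j S)
    have hAj1 : 1 ≤ A j := hA1 j (Finset.mem_insert_self j S)
    have hej0 : 0 ≤ e j := (abs_nonneg _).trans hej
    have hP1 : 1 ≤ ∏ i ∈ S, A i := by
      have h := Finset.prod_le_prod (s := S) (f := fun _ => (1:ℝ)) (g := A) (fun _ _ => zero_le_one) hA1'
      simpa using h
    have hsum0 : 0 ≤ ∑ i ∈ S, e i := Finset.sum_nonneg fun i hi => (abs_nonneg _).trans (he' i hi)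
    have hPS0 : 0 ≤ |∏ i ∈ S, a i - 1| := abs_nonneg _
    rw [Finset.prod_insert hj, Finset.prod_insert hj, Finset.sum_insert hj]
    have hsplit : a j * ∏ i ∈ S, a i - 1 = a j * (∏ i ∈ S, a i - 1) + (a j - 1) := by ring
    rw [hsplit]
    calc |a j * (∏ i ∈ S, a i - 1) + (a j - 1)| ≤ |a j * (∏ i ∈ S, a i - 1)| + |a j - 1| := abs_add_le _ _
      _ = |a j| * |∏ i ∈ S, a i - 1| + |a j - 1| := by rw [abs_mul]
      _ ≤ A j * ((∏ i ∈ S, A i) * ∑ i ∈ S, e i) + e j :=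
          add_le_add (mul_le_mul hAj ih' hPS0 ((abs_nonneg _).trans hAj)) hej
      _ ≤ (A j * ∏ i ∈ S, A i) * (e j + ∑ i ∈ S, e i) := by
          have hAP1 : 1 ≤ A j * ∏ i ∈ S, A i := one_le_mul_of_one_le_of_one_le hAj1 hP1
          nlinarith [mul_nonneg (sub_nonneg.2 hAP1) hej0, mul_nonneg (le_trans zero_le_one hAj1) (le_trans zero_le_one hP1)]

/-- **The torus envelope**: `|∏ᵢ zW Z W i x ^ nᵢ − 1| ≤ K(n) · Σ_{i∈Z} |κᵢ x|` when `|κᵢ x| ≤ 1/2` on `Z`,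
with the explicit constant `K(n) = (∏ᵢ 2^{nᵢ}) · Σᵢ nᵢ 2^{nᵢ}`. -/
theorem abs_prod_zW_pow_sub_one_le (Z : Fin q → Bool) (κ : Fin q → (Fin 1 → ℝ) → ℝ) (n : Fin q → ℕ)
    {x : Fin 1 → ℝ} (hsmall : ∀ i, Z i = true → |κ i x| ≤ 1 / 2) :
    |∏ i, zW Z (fun i x => 1 + κ i x) i x ^ n i - 1| ≤
      ((∏ i, (2 : ℝ) ^ n i) * ∑ i, (n i : ℝ) * 2 ^ n i) * ∑ i, (if Z i = true then |κ i x| else 0) := by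
  have h := abs_prod_sub_one_le (Finset.univ : Finset (Fin q))
    (a := fun i => zW Z (fun i x => 1 + κ i x) i x ^ n i)
    (e := fun i => (n i : ℝ) * 2 ^ n i * (if Z i = true then |κ i x| else 0))
    (A := fun i => (2 : ℝ) ^ n i) ?_ ?_ ?_
  · refine h.trans ?_
    have hK : 0 ≤ ∏ i, (2:ℝ) ^ n i := Finset.prod_nonneg fun i _ => by positivity
    rw [mul_assoc]
    refine mul_le_mul_of_nonneg_left ?_ hK
    rw [Finset.mul_sum]
    refine Finset.sum_le_sum fun i _ => ?_
    have hv : 0 ≤ (if Z i = true then |κ i x| else 0) := by split_ifs <;> simp [abs_nonneg]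
    have hle : (n i : ℝ) * 2 ^ n i ≤ ∑ j, (n j : ℝ) * 2 ^ n j :=
      Finset.single_le_sum (f := fun j => (n j : ℝ) * 2 ^ n j) (fun j _ => by positivity) (Finset.mem_univ i)
    exact mul_le_mul_of_nonneg_right hle hv
  · intro i _
    by_cases hZ : Z i = true
    · have h1 := abs_one_add_pow_sub_one_le (hsmall i hZ) (n i)
      simpa [zW, hZ] using h1
    · simp [zW, hZ]
  · intro i _
    by_cases hZ : Z i = true
    · simp only [zW, hZ, if_true]
      rw [abs_pow]
      refine pow_le_pow_left₀ (abs_nonneg _) ?_ _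
      have h1 := hsmall i hZ
      have h2 : |1 + κ i x| ≤ |(1:ℝ)| + |κ i x| := abs_add_le _ _
      rw [abs_one] at h2
      linarith
    · simp only [zW, hZ]
      simp only [Bool.false_eq_true, ↓reduceIte, one_pow, abs_one]
      exact one_le_pow₀ (by norm_num)
  · intro i _
    exact one_le_pow₀ (by norm_num)

/-- **Lower bound of the padded torus product**: `(1/2)^{Σ nᵢ} ≤ ∏ᵢ zW Z W i x ^ nᵢ` when `|κᵢ x| ≤ 1/2` on `Z`. -/
theorem prod_zW_pow_ge (Z : Fin q → Bool) (κ : Fin q → (Fin 1 → ℝ) → ℝ) (n : Fin q → ℕ)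
    {x : Fin 1 → ℝ} (hsmall : ∀ i, Z i = true → |κ i x| ≤ 1 / 2) :
    (1 / 2 : ℝ) ^ (∑ i, n i) ≤ ∏ i, zW Z (fun i x => 1 + κ i x) i x ^ n i := by
  rw [← Finset.prod_pow_eq_pow_sum]
  refine Finset.prod_le_prod (fun i _ => by positivity) fun i _ => ?_
  by_cases hZ : Z i = true
  · simp only [zW, hZ, if_true]
    refine pow_le_pow_left₀ (by norm_num) ?_ _
    have h1 := (abs_le.1 (hsmall i hZ)).1
    linarith
  · simp only [zW, hZ, Bool.false_eq_true, ↓reduceIte, one_pow]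
    exact pow_le_one₀ (by norm_num) (by norm_num)

end T3
end Summit.KontsevichZagierPeriods.RootDecompRelativeModAbsolute.Rung30571.RegularisedLogLayer.CylLog.Leaf
end
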